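import Literature.Barriers.CriticalPhenomena.FiniteRangeDecompositionMassless
import Literature.Barriers.CriticalPhenomena.RigorousRGSmallParameterSelfSimilarCovariance
import HarnessLib

/-!
# Asymptotic self-similarity of the finite-range decomposition of `(-Δ_{ℤ^d}+s)⁻¹` itself:
# `C_{j+1;0,x}(s) = (L^{j+1})^{2-d}(G_L(x/L^{j+1}, s(L^{j+1})²) + O(1/L^{j+1}))` for `s ∈ [0,1]`

Companion of `RigorousRGSmallParameterSelfSimilarCovariance.lean` (Slade's Lemma 10.3.1 for the
FRACTIONAL covariances `C_j = ∫Γ_j(s)ρ(s)ds` of Slade, CMP 358 (2018), §10.3, built on the lattice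
kernels of R. Bauerschmidt, PTRF 157 (2013) [Baue13a] through "(10.38) `w(t,x;s) =
(c/t)^{d-2}w̄(cx/t;st²) + O(t^{-(d-1)}(1+st²)^{-p})` … uniform in bounded `s`, and in particular for
`s ≤ 1`" — the tree's `FRD.abs_wKer_sub_wKerCont0_le`, with the inner kernel
`G_L(y,σ) = ∫_{(1/(2L),1/2]}(dτ/τ)(M₀/τ)^d(τ²/(2dc))w̄(M₀y/τ; στ²/(2d))` = `FRD.cZeroKer` and the scaling
identity `FRD.setIntegral_wKerCont0_div_eq`) and of `FiniteRangeDecompositionMassless.lean` (the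
terms `Γ_j(s) = FRD.Gam d L s j` of the decomposition of `(-Δ_{ℤ^d}+s)⁻¹` at `s = 0` as limits
`s ↓ 0`). It gives the same asymptotic self-similarity ONE LEVEL DOWN, for the terms `Γ_j(s)` of the
decomposition of the standard (nearest-neighbour) Laplacian resolvent — the covariance decomposition
used by Bauerschmidt–Brydges–Slade, CMP 337 (2015) [BBS2015] for the 4-dimensional weakly
self-avoiding walk ("The decompositions we use are defined and discussed in detail in [BBS-rg-pt],
based on [Baue13a]", §5.1), whose perturbative coefficients `β_j` (§6.1) are quadratic in these
`Γ_j`, so that their scaling limits (`lim_jβ_j` at `m² = 0`, Assumption (A1)) rest on: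

* `continuousWithinAt_wbar_sigma` — `σ ↦ w̄(y;σ)` is continuous on `[0,∞)` (dominated convergence,
  Schwartz decay of the profile);
* `abs_cZeroIntegrand_le`, **`continuousWithinAt_cZeroKer_sigma`** — `σ ↦ G_L(y,σ)` is continuous on
  `[0,∞)`, including `σ = 0` (dominated convergence over the `τ`-interval);
* **`abs_Gam_sub_scaling_le_of_pos`** — for `d ≥ 1`, `L ≥ 2` there is `C` with, for all `s ∈ (0,1]`,
  `j ≥ 1`, `x ∈ ℤ^d` and `Λ = L^{j+1}`:
  `|Γ_{j+1}(x;s) - (Λ²/Λ^d)G_L(x/Λ, sΛ²)| ≤ C(Λ/Λ^d)` — Slade's display (10.41)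
  `C_{j;0,x}(m²) = L^{-(d-α)j}(c₀(L^{-j}x, m²L^{αj}) + O(L^{-j}))` with `d-α ↦ d-2` and no mass
  integral, i.e. [Baue13a]'s "`φ_t(x,y;a,m²) = t^{-(d-2)}φ̄((x-y)/t; a, m²t²)` … this is scale
  invariance … the discrete Green's function has a scaling limit and the error is of the order of the
  rescaled lattice spacing `O(t⁻¹)`" integrated over the scale interval `(½L^j, ½L^{j+1}]`;
* **`abs_Gam_sub_scaling_le`** — the same for all `s ∈ [0,1]`, the case `s = 0` (the critical point
  of [BBS2015]) by passing to the limit `s ↓ 0` on both sides.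

Everything is proved; no definition and no named fact is introduced.
-/

noncomputable section

namespace Literature.Barriers.CriticalPhenomena

open _root_.MeasureTheory Set Filter
open scoped _root_.Topology Real

namespace LongRangePhi4

namespace FRD

open Literature.Probability.LatticeModels

variable {d : ℕ}

/-! ### Continuity of `w̄(y;σ)` and of `G_L(y,σ)` in `σ ∈ [0,∞)` -/

/-- **`σ ↦ w̄(y;σ)` is continuous on `[0,∞)`** (`d ≥ 1`): dominated convergence over `ℝ^d` with the
Schwartz decay `|f(√(|u|₂²+σ))| ≤ C(1+‖u‖²)^{-d}`. [cite: Slade2017, §10.3 ("a smooth function c₀ : ℝ^d × [0,∞) → ℝ")] -/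
theorem continuousWithinAt_wbar_sigma (hd : 1 ≤ d) (y : Fin d → ℝ) (σ₀ : ℝ) :
    ContinuousWithinAt (fun σ => wbar d σ y) (Ici 0) σ₀ := by
  have hsq : Continuous (sqNorm : (Fin d → ℝ) → ℝ) := by
    unfold sqNorm; fun_prop
  set g : (Fin d → ℝ) → ℝ := fun u => ((1 + ‖u‖ ^ 2) ^ d)⁻¹ with hg
  have hgi : Integrable g := integrable_inv_one_add_norm_sq_pow (by omega)
  obtain ⟨C, hC, hf⟩ := abs_profile_sqrt_le profile d
  have hmem : ∀ᶠ σ in 𝓝[Ici (0 : ℝ)] σ₀, (0 : ℝ) ≤ σ := eventually_mem_nhdsWithin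
  unfold wbar
  refine ContinuousWithinAt.mul continuousWithinAt_const ?_
  refine continuousWithinAt_of_dominated (bound := fun u => C * g u) ?_ ?_ (hgi.const_mul C) ?_
  · filter_upwards [hmem] with σ hσ
    exact ((Complex.continuous_re.comp (profile.continuous.comp
      (hsq.add continuous_const).sqrt)).mul (Real.continuous_cos.comp (by fun_prop))).aestronglyMeasurable
  · filter_upwards [hmem] with σ hσ
    refine ae_of_all _ fun u => ?_
    rw [Real.norm_eq_abs, abs_mul]
    refine (mul_le_of_le_one_right (abs_nonneg _) (Real.abs_cos_le_one _)).trans ?_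
    have hζ : 0 ≤ sqNorm u + σ := add_nonneg (sqNorm_nonneg u) hσ
    have h1 := hf 1 zero_le_one (sqNorm u + σ) hζ
    rw [one_mul, one_pow, one_mul] at h1
    refine h1.trans ?_
    rw [hg]
    refine mul_le_mul_of_nonneg_left ?_ hC.le
    refine inv_anti₀ (by positivity) (pow_le_pow_left₀ (by positivity) ?_ d)
    linarith [norm_sq_le_sqNorm u]
  · refine ae_of_all _ fun u => ?_
    refine ContinuousWithinAt.mul ?_ continuousWithinAt_const
    exact ((Complex.continuous_re.comp (profile.continuous.comp
      ((continuous_const.add continuous_id).sqrt))).continuousWithinAt)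

/-- A pointwise bound on the `τ`-integrand of `G_L`: for `d ≥ 1`, `L ≥ 1` there is `P` with
`|(M₀/τ)^d(τ²/(2dc))w̄(M₀y/τ; στ²/(2d))/τ| ≤ P` for all `τ ∈ (1/(2L), 1/2]`, `σ ≥ 0`, `y`.
[cite: Slade2017, §10.3 (displays (10.39)–(10.40))] -/
theorem abs_cZeroIntegrand_le (hd : 1 ≤ d) {L : ℝ} (hL : 1 ≤ L) :
    ∃ P : ℝ, 0 < P ∧ ∀ σ : ℝ, 0 ≤ σ → ∀ y : Fin d → ℝ, ∀ τ ∈ Ioc (1 / (2 * L)) (1 / 2),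
      |cZeroIntegrand d y σ τ| ≤ P := by
  have hd' : (1 : ℝ) ≤ d := by exact_mod_cast hd
  have hc := cProfile_pos
  obtain ⟨C, hC, hw⟩ := abs_wbar_le hd 0
  have hM0 : 0 < Real.sqrt (2 * d) := Real.sqrt_pos.2 (by positivity)
  have hL0 : 0 < L := by linarith
  refine ⟨(Real.sqrt (2 * d) * (2 * L)) ^ d * (1 / (cProfile * (2 * d))) * C * (2 * L),
    by positivity, fun σ hσ y τ hτ => ?_⟩
  have hτ0 : 0 < τ := lt_trans (by positivity) hτ.1
  have hτL : 1 / (2 * L) < τ := hτ.1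
  have hτ2 : τ ≤ 1 / 2 := hτ.2
  unfold cZeroIntegrand
  rw [abs_div, abs_of_pos hτ0, abs_mul, abs_mul]
  have h1 : |(Real.sqrt (2 * d) / τ) ^ d| ≤ (Real.sqrt (2 * d) * (2 * L)) ^ d := by
    rw [abs_of_nonneg (by positivity)]
    refine pow_le_pow_left₀ (by positivity) ?_ d
    rw [div_le_iff₀ hτ0]
    have : 1 ≤ 2 * L * τ := by
      rw [div_lt_iff₀ (by positivity)] at hτL; linarith
    nlinarith [hM0.le]
  have h2 : |τ ^ 2 / (cProfile * (2 * d))| ≤ 1 / (cProfile * (2 * d)) := by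
    rw [abs_of_nonneg (by positivity)]
    refine div_le_div_of_nonneg_right ?_ (by positivity)
    nlinarith
  have h3 : |wbar d (σ * τ ^ 2 / (2 * d)) fun i => Real.sqrt (2 * d) * y i / τ| ≤ C := by
    have := hw (σ * τ ^ 2 / (2 * d)) (by positivity) (fun i => Real.sqrt (2 * d) * y i / τ)
    simpa using this
  have h4 : (1 : ℝ) / τ ≤ 2 * L := by
    rw [div_le_iff₀ hτ0]
    rw [div_lt_iff₀ (by positivity)] at hτL; linarith
  calc |(Real.sqrt (2 * d) / τ) ^ d| * |τ ^ 2 / (cProfile * (2 * d))| *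
        |wbar d (σ * τ ^ 2 / (2 * d)) fun i => Real.sqrt (2 * d) * y i / τ| / τ
      = |(Real.sqrt (2 * d) / τ) ^ d| * |τ ^ 2 / (cProfile * (2 * d))| *
        |wbar d (σ * τ ^ 2 / (2 * d)) fun i => Real.sqrt (2 * d) * y i / τ| * (1 / τ) := by ring
    _ ≤ (Real.sqrt (2 * d) * (2 * L)) ^ d * (1 / (cProfile * (2 * d))) * C * (2 * L) := by
        gcongr

/-- **`σ ↦ G_L(y,σ)` is continuous on `[0,∞)`, including `σ = 0`** (`d ≥ 1`, `L ≥ 1`): dominated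
convergence over `τ ∈ (1/(2L), 1/2]` with the constant bound of `abs_cZeroIntegrand_le`.
[cite: Slade2017, §10.3 ("a smooth function c₀ : ℝ^d × [0,∞) → ℝ")] -/
theorem continuousWithinAt_cZeroKer_sigma (hd : 1 ≤ d) {L : ℝ} (hL : 1 ≤ L) (y : Fin d → ℝ)
    (σ₀ : ℝ) : ContinuousWithinAt (fun σ => cZeroKer d L y σ) (Ici 0) σ₀ := by
  have hd' : (0 : ℝ) < d := by exact_mod_cast hd
  obtain ⟨P, hP, hb⟩ := abs_cZeroIntegrand_le hd hL
  have hmem : ∀ᶠ σ in 𝓝[Ici (0 : ℝ)] σ₀, (0 : ℝ) ≤ σ := eventually_mem_nhdsWithin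
  haveI : IsFiniteMeasure ((volume : Measure ℝ).restrict (Ioc (1 / (2 * L)) (1 / 2))) :=
    isFiniteMeasure_restrict.2 (by rw [Real.volume_Ioc]; exact ENNReal.ofReal_ne_top)
  unfold cZeroKer
  refine continuousWithinAt_of_dominated (bound := fun _ => P) ?_ ?_ (integrable_const P) ?_
  · exact Eventually.of_forall fun σ => (measurable_cZeroIntegrand_right y σ).aestronglyMeasurable
  · filter_upwards [hmem] with σ hσ
    refine (ae_restrict_iff' measurableSet_Ioc).2 (ae_of_all _ fun τ hτ => ?_)
    rw [Real.norm_eq_abs]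
    exact hb σ hσ y τ hτ
  · refine (ae_restrict_iff' measurableSet_Ioc).2 (ae_of_all _ fun τ hτ => ?_)
    have hτ0 : 0 < τ := lt_trans (by positivity) hτ.1
    unfold cZeroIntegrand
    refine ((continuousWithinAt_const.mul ?_).div_const τ)
    -- `σ ↦ w̄(M₀y/τ; στ²/(2d))` within `[0,∞)`
    have hmap : MapsTo (fun σ : ℝ => σ * τ ^ 2 / (2 * d)) (Ici 0) (Ici 0) := fun σ hσ => by
      have : (0 : ℝ) ≤ σ := hσ
      show (0 : ℝ) ≤ σ * τ ^ 2 / (2 * d)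
      positivity
    have hin : ContinuousWithinAt (fun σ : ℝ => σ * τ ^ 2 / (2 * d)) (Ici 0) σ₀ :=
      (by fun_prop : Continuous fun σ : ℝ => σ * τ ^ 2 / (2 * d)).continuousWithinAt
    have hg := continuousWithinAt_wbar_sigma hd (fun i => Real.sqrt (2 * d) * y i / τ)
      (σ₀ * τ ^ 2 / (2 * d))
    exact ContinuousWithinAt.comp (f := fun σ : ℝ => σ * τ ^ 2 / (2 * d)) hg hin hmap

/-- `G_L(x/Λ, sΛ²) → G_L(x/Λ, 0)` as `s ↓ 0`. [folklore] -/
theorem tendsto_cZeroKer_mass (hd : 1 ≤ d) {L : ℝ} (hL : 1 ≤ L) (y : Fin d → ℝ) (Λ : ℝ) :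
    Tendsto (fun s : ℝ => cZeroKer d L y (s * Λ ^ 2)) (𝓝[>] 0) (𝓝 (cZeroKer d L y 0)) := by
  have h0 := continuousWithinAt_cZeroKer_sigma hd hL y (0 * Λ ^ 2)
  have hmap : MapsTo (fun s : ℝ => s * Λ ^ 2) (Ici 0) (Ici 0) := fun s hs => by
    have : (0 : ℝ) ≤ s := hs
    show (0 : ℝ) ≤ s * Λ ^ 2
    positivity
  have hin : ContinuousWithinAt (fun s : ℝ => s * Λ ^ 2) (Ici 0) 0 :=
    (by fun_prop : Continuous fun s : ℝ => s * Λ ^ 2).continuousWithinAt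
  have h1 : ContinuousWithinAt (fun s : ℝ => cZeroKer d L y (s * Λ ^ 2)) (Ici 0) 0 :=
    ContinuousWithinAt.comp (f := fun s : ℝ => s * Λ ^ 2) h0 hin hmap
  have h2 := h1.tendsto
  simp only [zero_mul] at h2
  exact h2.mono_left (nhdsWithin_mono _ Ioi_subset_Ici_self)

/-! ### The self-similarity of `Γ_{j+1}(s)` for `s ∈ (0,1]` -/

/-- **Asymptotic self-similarity of the decomposition of `(-Δ_{ℤ^d}+s)⁻¹`, massive case**: for
`d ≥ 1`, `L ≥ 2` there is `C` such that for all `s ∈ (0,1]`, `j ≥ 1`, `x ∈ ℤ^d`, with `Λ = L^{j+1}`,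
`|Γ_{j+1}(x;s) - (Λ²/Λ^d)G_L(x/Λ, sΛ²)| ≤ C(Λ/Λ^d)` — the scale integral over `(½L^j, ½L^{j+1}]` of
(10.38) `w = w₀ + O(t^{1-d})`, the continuum term being exactly `(Λ²/Λ^d)G_L(x/Λ, sΛ²)` by scale
invariance (`setIntegral_wKerCont0_div_eq`) and the error `∫(2L/Λ)^d dt ≤ C₀2^{d-1}L^dΛ^{1-d}`.
[cite: Slade2017, Lemma 10.3.1 (display (10.41), here for Γ_j itself: d-α ↦ d-2, no mass integral)] [cite: Bauerschmidt2013, Example 1.3 (display (eq:const-coeff-w-w*-approximation), l_x = l_y = 0: "the error is of the order of the rescaled lattice spacing O(t⁻¹)")] -/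
theorem abs_Gam_sub_scaling_le_of_pos (hd : 1 ≤ d) {L : ℝ} (hL : 2 ≤ L) :
    ∃ C : ℝ, 0 < C ∧ ∀ s : ℝ, 0 < s → s ≤ 1 → ∀ j : ℕ, 1 ≤ j → ∀ x : Site d,
      |Gam d L s (j + 1) x - (L ^ (j + 1)) ^ 2 / (L ^ (j + 1)) ^ d *
          cZeroKer d L (fun i => (x i : ℝ) / L ^ (j + 1)) (s * (L ^ (j + 1)) ^ 2)| ≤
        C * (L ^ (j + 1) / (L ^ (j + 1)) ^ d) := by
  obtain ⟨C₀, hC₀, h₀⟩ := abs_wKer_sub_wKerCont0_le hd 0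
  have hL1 : (1 : ℝ) ≤ L := by linarith
  have hL0 : (0 : ℝ) < L := by linarith
  refine ⟨C₀ * 2 ^ d * L ^ d, by positivity, fun s hs hs1 j hj x => ?_⟩
  set Λ : ℝ := L ^ (j + 1) with hΛ
  have hΛ0 : 0 < Λ := by rw [hΛ]; positivity
  -- the scale interval of `Γ_{j+1}` is `(Λ/(2L), Λ/2]`, with `Λ/(2L) = ½L^j ≥ 1`
  have hlow : scaleLower L (j + 1) = Λ / (2 * L) := by
    unfold scaleLower
    rw [if_neg (by omega), Nat.add_sub_cancel, hΛ, pow_succ]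
    field_simp
  have hup : L ^ (j + 1) / 2 = Λ / 2 := by rw [hΛ]
  have ha1 : 1 ≤ Λ / (2 * L) := by
    rw [le_div_iff₀ (by positivity), hΛ, pow_succ]
    have : (2 : ℝ) ≤ L ^ j := by
      calc (2 : ℝ) ≤ L := hL
        _ = L ^ 1 := (pow_one L).symm
        _ ≤ L ^ j := pow_le_pow_right₀ hL1 hj
    nlinarith
  have hI1 : IntegrableOn (fun t : ℝ => wKer d s t x / t) (Ioc (Λ / (2 * L)) (Λ / 2)) :=
    integrableOn_wKer_div_Ioc hs x (by positivity)
  have hI2 : IntegrableOn (fun t : ℝ => wKerCont0 d s t x / t) (Ioc (Λ / (2 * L)) (Λ / 2)) :=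
    integrableOn_wKerCont0_div_Ioc hd hs hs1 x ha1
  -- split `w = w₀ + (w - w₀)`
  have hI3 : IntegrableOn (fun t : ℝ => (wKer d s t x - wKerCont0 d s t x) / t)
      (Ioc (Λ / (2 * L)) (Λ / 2)) := by
    refine (hI1.sub hI2).congr (ae_of_all _ fun t => ?_)
    simp only [Pi.sub_apply]
    ring
  have hsplit : Gam d L s (j + 1) x = (∫ t in Ioc (Λ / (2 * L)) (Λ / 2), wKerCont0 d s t x / t) +
      ∫ t in Ioc (Λ / (2 * L)) (Λ / 2), (wKer d s t x - wKerCont0 d s t x) / t := by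
    unfold Gam
    rw [hlow, hup, ← integral_add hI2 hI3]
    refine setIntegral_congr_fun measurableSet_Ioc fun t _ => ?_
    ring
  rw [hsplit, setIntegral_wKerCont0_div_eq hd hs.le hΛ0 hL1 x, add_sub_cancel_left]
  -- the error integral
  have hμ : (volume : Measure ℝ) (Ioc (Λ / (2 * L)) (Λ / 2)) < ⊤ := by
    rw [Real.volume_Ioc]; exact ENNReal.ofReal_lt_top
  have hbound : ∀ t ∈ Ioc (Λ / (2 * L)) (Λ / 2),
      ‖(wKer d s t x - wKerCont0 d s t x) / t‖ ≤ C₀ * (2 * L / Λ) ^ d := by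
    intro t ht
    have ht1 : 1 ≤ t := le_trans ha1 ht.1.le
    have ht0 : 0 < t := by linarith
    have h1 := h₀ s hs hs1 t ht1 x
    rw [pow_zero, inv_one, mul_one] at h1
    rw [Real.norm_eq_abs, abs_div, abs_of_pos ht0, div_le_iff₀ ht0]
    refine h1.trans ?_
    -- `(t²/t^d)t⁻¹ ≤ (2L/Λ)^d t`, i.e. `1 ≤ (2L t/Λ)^d`
    have hq : Λ / (2 * L) ≤ t := ht.1.le
    have hr : 1 ≤ 2 * L / Λ * t := by
      rw [div_mul_eq_mul_div, le_div_iff₀ hΛ0, one_mul]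
      rw [div_le_iff₀ (by positivity)] at hq; linarith
    have hrd : 1 ≤ (2 * L / Λ * t) ^ d := one_le_pow₀ hr
    have htd : 0 < t ^ d := pow_pos ht0 d
    have e : C₀ * (2 * L / Λ) ^ d * t = C₀ * (t ^ 2 / t ^ d) * t⁻¹ * (2 * L / Λ * t) ^ d := by
      rw [mul_pow]
      field_simp
    rw [e]
    have h3 : 0 ≤ C₀ * (t ^ 2 / t ^ d) * t⁻¹ := by positivity
    calc C₀ * (t ^ 2 / t ^ d) * t⁻¹ = C₀ * (t ^ 2 / t ^ d) * t⁻¹ * 1 := (mul_one _).symm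
      _ ≤ C₀ * (t ^ 2 / t ^ d) * t⁻¹ * (2 * L / Λ * t) ^ d :=
          mul_le_mul_of_nonneg_left hrd h3
  have hE := norm_setIntegral_le_of_norm_le_const hμ hbound
  rw [Real.norm_eq_abs] at hE
  refine hE.trans ?_
  rw [Measure.real, Real.volume_Ioc, ENNReal.toReal_ofReal (by
    have : Λ / (2 * L) ≤ Λ / 2 := by
      rw [div_le_div_iff₀ (by positivity) (by positivity)]; nlinarith
    linarith)]
  -- `C₀(2L/Λ)^d · (Λ/2 - Λ/(2L)) ≤ C₀2^dL^d Λ/Λ^d`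
  have hlen : Λ / 2 - Λ / (2 * L) ≤ Λ := by
    have h1 : 0 ≤ Λ / (2 * L) := by positivity
    linarith
  have hfac : (2 * L / Λ) ^ d = 2 ^ d * L ^ d / Λ ^ d := by rw [div_pow, mul_pow]
  rw [hfac]
  have hnn : 0 ≤ C₀ * (2 ^ d * L ^ d / Λ ^ d) := by positivity
  calc C₀ * (2 ^ d * L ^ d / Λ ^ d) * (Λ / 2 - Λ / (2 * L)) ≤ C₀ * (2 ^ d * L ^ d / Λ ^ d) * Λ :=
        mul_le_mul_of_nonneg_left hlen hnn
    _ = C₀ * 2 ^ d * L ^ d * (Λ / Λ ^ d) := by ring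

/-! ### The self-similarity for `s ∈ [0,1]`, including the critical value `s = 0` -/

/-- **Asymptotic self-similarity of the decomposition of `(-Δ_{ℤ^d}+s)⁻¹` for `s ∈ [0,1]`**: for
`d ≥ 1`, `L ≥ 2` there is `C` such that for all `s ∈ [0,1]`, `j ≥ 1`, `x ∈ ℤ^d`, with `Λ = L^{j+1}`,
`|Γ_{j+1}(x;s) - (Λ²/Λ^d)G_L(x/Λ, sΛ²)| ≤ C(Λ/Λ^d)`; at `s = 0`:
`Γ_{j+1}(x;0) = Λ^{2-d}(G_L(x/Λ, 0) + O(Λ⁻¹))`, the massless terms being the limits `s ↓ 0`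
(`tendsto_Gam_mass`, `tendsto_cZeroKer_mass`). [cite: Slade2017, Lemma 10.3.1 (display (10.41) at m² = 0, for Γ_j itself)] [cite: Bauerschmidt2013, Example 1.3 (scale invariance φ_t = t^{-(d-2)}φ̄(·/t; m²t²) and the O(t⁻¹) lattice error)] -/
theorem abs_Gam_sub_scaling_le (hd : 1 ≤ d) {L : ℝ} (hL : 2 ≤ L) :
    ∃ C : ℝ, 0 < C ∧ ∀ s : ℝ, 0 ≤ s → s ≤ 1 → ∀ j : ℕ, 1 ≤ j → ∀ x : Site d,
      |Gam d L s (j + 1) x - (L ^ (j + 1)) ^ 2 / (L ^ (j + 1)) ^ d *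
          cZeroKer d L (fun i => (x i : ℝ) / L ^ (j + 1)) (s * (L ^ (j + 1)) ^ 2)| ≤
        C * (L ^ (j + 1) / (L ^ (j + 1)) ^ d) := by
  obtain ⟨C, hC, h⟩ := abs_Gam_sub_scaling_le_of_pos hd hL
  refine ⟨C, hC, fun s hs hs1 j hj x => ?_⟩
  rcases hs.lt_or_eq with hs' | hs'
  · exact h s hs' hs1 j hj x
  · rw [← hs']
    have hL1 : (1 : ℝ) ≤ L := by linarith
    have hT : Tendsto (fun s : ℝ => Gam d L s (j + 1) x - (L ^ (j + 1)) ^ 2 / (L ^ (j + 1)) ^ d *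
        cZeroKer d L (fun i => (x i : ℝ) / L ^ (j + 1)) (s * (L ^ (j + 1)) ^ 2)) (𝓝[>] 0)
        (𝓝 (Gam d L 0 (j + 1) x - (L ^ (j + 1)) ^ 2 / (L ^ (j + 1)) ^ d *
          cZeroKer d L (fun i => (x i : ℝ) / L ^ (j + 1)) 0)) :=
      (tendsto_Gam_mass hd (by linarith) (j + 1) x).sub
        ((tendsto_cZeroKer_mass hd hL1 _ _).const_mul _)
    rw [show (0 : ℝ) * (L ^ (j + 1)) ^ 2 = 0 by ring]
    refine le_of_tendsto ((continuous_abs.tendsto _).comp hT) ?_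
    filter_upwards [Ioc_mem_nhdsGT (zero_lt_one' ℝ)] with s hs''
    exact h s hs''.1 hs''.2 j hj x

end FRD

end LongRangePhi4

end Literature.Barriers.CriticalPhenomena
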